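import Literature.AlgebraicTopology.Homotopy.SphereMapsHomotopyGroups
import Literature.AlgebraicTopology.Homotopy.BasedMaps
import HarnessLib

/-!
# Every element of `π_N(Y, y)` is carried by a map of the sphere `Sᴺ → Y`

Topic `Literature/AlgebraicTopology/Homotopy`. A. Hatcher, *Algebraic Topology* (2002), §4.1,
p. 340: "we can also view `πₙ(X, x₀)` as homotopy classes of maps `(Sⁿ, s₀) → (X, x₀)`" — maps
of the cube `(Iⁿ, ∂Iⁿ) → (X, x₀)` "are the same as maps of the quotient `Iⁿ/∂Iⁿ = Sⁿ`". Mathlib's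
`π_ N Y y = HomotopyGroup (Fin N) Y y` consists of classes of cube maps; this file PROVES the
half of the identification that is needed to REALISE classes by sphere maps (no definitions, no
named facts):

* `exists_sphereMap_genLoop_eq` — every generalized loop `f : (Iᴺ, ∂Iᴺ) → (Y, y)` factors as
  `f = g ∘ κ` with `g : Sᴺ → Y` continuous, `κ : (Iᴺ, ∂Iᴺ) → (Sᴺ, s)` a generalized loop of the
  sphere (the collapse `Iᴺ → ℝᴺ ∪ {∞} ≅ Sᴺ` of Hatcher p. 340: the interior blown up radially onto
  `ℝᴺ`, the boundary sent to `∞ ↦ s`) and `g s = y`;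
* **`exists_sphereMap_mem_range`** — hence every `γ ∈ π_N(Y, y)` lies in the image of
  `g_* : π_N(Sᴺ, s) → π_N(Y, y)` for some continuous `g : Sᴺ → Y` with `g s = y`
  (`g_*` = `homotopyGroupMapOfEq g _` of `BasedMaps.lean`), namely `γ = g_* [κ]`.

The collapse and the factorisation are those written inline in the proof of
`subsingleton_homotopyGroup_of_sphereMaps_nullhomotopic` (`SphereMapsHomotopyGroups.lean`, the
direction (1) ⇒ (3) of Hatcher's criterion p. 346); here they are recorded as a statement of their
own, the form consumed when a chosen generator of some `π_N(Y)` has to be hit by a map from `Sᴺ`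
(e.g. to start a cell-by-cell comparison map into a `K(π, N)`).

## References

* A. Hatcher, *Algebraic Topology*, CUP (2002), §4.1 p. 340 (cube maps versus sphere maps),
  p. 346. [HatcherAT2002]
-/

noncomputable section

open Set Metric Topology unitInterval Function Module Filter
open scoped Topology Topology.Homotopy ContinuousMap OnePoint

namespace Literature.AlgebraicTopology.Homotopy

variable {N : ℕ} {Y : Type*} [TopologicalSpace Y] {y : Y}

/-- **Cube loops factor through the sphere** (Hatcher 2002, §4.1 p. 340: maps
`(Iⁿ, ∂Iⁿ) → (X, x₀)` "are the same as maps of the quotient `Iⁿ/∂Iⁿ = Sⁿ`"): for every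
generalized loop `f : (Iᴺ, ∂Iᴺ) → (Y, y)` there are a point `s ∈ Sᴺ`, a generalized loop
`κ : (Iᴺ, ∂Iᴺ) → (Sᴺ, s)` (the collapse of the boundary, independent of `f`) and a continuous
`g : Sᴺ → Y` with `g s = y` and `g ∘ κ = f`. [cite: HatcherAT2002, §4.1 p. 340] -/
theorem exists_sphereMap_genLoop_eq (f : Ω^ (Fin N) Y y) :
    ∃ (s : sphere (0 : EuclideanSpace ℝ (Fin (N + 1))) 1)
      (κ : Ω^ (Fin N) (sphere (0 : EuclideanSpace ℝ (Fin (N + 1))) 1) s)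
      (g : C(sphere (0 : EuclideanSpace ℝ (Fin (N + 1))) 1, Y)) (hg : y = g s),
      genLoopMapOfEq g hg κ = f := by
  classical
  have hfb : ∀ x ∈ Cube.boundary (Fin N), f x = y := fun x hx => f.2 x hx
  -- centred coordinates of the cube in `V = ℝᴺ` (sup norm): `cubeRad = 2 ‖wv‖`
  set wv : (Fin N → I) → (Fin N → ℝ) := fun x i => (x i : ℝ) - 2⁻¹ with hwv
  have hwvc : Continuous wv :=
    continuous_pi fun i => (continuous_subtype_val.comp (continuous_apply i)).sub continuous_const
  have hrad : ∀ x, cubeRad x = 2 * ‖wv x‖ := by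
    intro x
    rw [cubeRad, dist_eq_norm]
    rfl
  -- the interior `U = {cubeRad < 1}`; its complement is the boundary
  set U : Set (Fin N → I) := {x | cubeRad x < 1} with hU
  have hUo : IsOpen U := isOpen_lt continuous_cubeRad continuous_const
  have hbd_of_not_mem : ∀ x, x ∉ U → x ∈ Cube.boundary (Fin N) := by
    intro x hx
    have h1 : 1 ≤ cubeRad x := not_lt.1 hx
    simpa only [cubeScale_one] using cubeScale_mem_boundary one_pos h1
  have hnot_mem_of_bd : ∀ x ∈ Cube.boundary (Fin N), x ∉ U := by
    intro x hx hxU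
    have : cubeRad x < 1 := hxU
    rw [cubeRad_eq_one_of_mem_boundary hx] at this
    exact lt_irrefl _ this
  -- the blow-up `τ` of the interior onto `ℝᴺ` and the collapse `c : Iᴺ → ℝᴺ ∪ {∞}`
  set τ : (Fin N → I) → (Fin N → ℝ) := fun x => (1 - cubeRad x)⁻¹ • wv x with hτ
  have hUlt : ∀ x ∈ U, cubeRad x < 1 := fun x hx => hx
  have hτc : ContinuousOn τ U := by
    have h1 : ContinuousOn (fun x : Fin N → I => (1 - cubeRad x)⁻¹) U :=
      ((continuous_const.sub continuous_cubeRad).continuousOn).inv₀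
        fun x hx => (sub_pos.2 (hUlt x hx)).ne'
    exact h1.smul hwvc.continuousOn
  have hτinf : ∀ a ∉ U, Tendsto (fun x => ‖τ x‖) (𝓝[U] a) atTop := by
    intro a ha
    have ha1 : cubeRad a = 1 := le_antisymm (cubeRad_le_one a) (not_lt.1 ha)
    have heq : ∀ x ∈ U, ‖wv x‖ * (1 - cubeRad x)⁻¹ = ‖τ x‖ := by
      intro x hx
      have hx' : cubeRad x < 1 := hx
      rw [hτ]
      dsimp only
      rw [norm_smul, norm_inv, Real.norm_of_nonneg (sub_nonneg.2 hx'.le), mul_comm]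
    have h1 : Tendsto (fun x => ‖wv x‖) (𝓝[U] a) (𝓝 (2⁻¹)) := by
      have hwa : ‖wv a‖ = 2⁻¹ := by
        have := hrad a
        rw [ha1] at this
        linarith
      rw [← hwa]
      exact ((continuous_norm.comp hwvc).tendsto a).mono_left nhdsWithin_le_nhds
    have h2 : Tendsto (fun x => (1 - cubeRad x)⁻¹) (𝓝[U] a) atTop := by
      refine tendsto_inv_nhdsGT_zero.comp ?_
      rw [tendsto_nhdsWithin_iff]
      constructor
      · have h3 : Tendsto (fun x => (1 : ℝ) - cubeRad x) (𝓝 a) (𝓝 (1 - cubeRad a)) :=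
          (continuous_const.sub continuous_cubeRad).tendsto a
        rw [ha1, sub_self] at h3
        exact h3.mono_left nhdsWithin_le_nhds
      · exact eventually_mem_nhdsWithin.mono fun x hx => mem_Ioi.2 (sub_pos.2 (hUlt x hx))
    exact (h1.pos_mul_atTop (by norm_num) h2).congr' (eventually_mem_nhdsWithin.mono heq)
  let c : (Fin N → I) → OnePoint (Fin N → ℝ) := OnePointMaps.coeOrInfty U τ
  have hcc : Continuous c := OnePointMaps.continuous_coeOrInfty hUo hτc hτinf
  -- the inverse `σ : ℝᴺ → interior` of the blow-up
  have hden : ∀ v : Fin N → ℝ, 0 < 1 + 2 * ‖v‖ := fun v => by positivity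
  set sig : (Fin N → ℝ) → (Fin N → I) :=
    fun v i => Set.projIcc (0 : ℝ) 1 zero_le_one (2⁻¹ + (1 + 2 * ‖v‖)⁻¹ * v i) with hsig
  have hsigc : Continuous sig := by
    refine continuous_pi fun i => continuous_projIcc.comp ?_
    exact continuous_const.add (((continuous_const.add (continuous_const.mul continuous_norm)).inv₀
      fun v => (hden v).ne').mul (continuous_apply i))
  have hsigval : ∀ v i, ((sig v i : I) : ℝ) = 2⁻¹ + (1 + 2 * ‖v‖)⁻¹ * v i := by
    intro v i
    have hvi : |v i| ≤ ‖v‖ := by simpa only [Real.norm_eq_abs] using norm_le_pi_norm v i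
    have hb : |(1 + 2 * ‖v‖)⁻¹ * v i| ≤ 2⁻¹ := by
      rw [abs_mul, abs_inv, abs_of_pos (hden v), inv_mul_le_iff₀ (hden v)]
      nlinarith [hvi, abs_nonneg (v i), norm_nonneg v]
    have hmem : 2⁻¹ + (1 + 2 * ‖v‖)⁻¹ * v i ∈ Icc (0 : ℝ) 1 := by
      rw [mem_Icc]
      constructor
      · linarith [neg_abs_le ((1 + 2 * ‖v‖)⁻¹ * v i)]
      · linarith [le_abs_self ((1 + 2 * ‖v‖)⁻¹ * v i)]
    rw [hsig]
    dsimp only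
    rw [Set.projIcc_of_mem _ hmem]
  have hwsig : ∀ v, wv (sig v) = (1 + 2 * ‖v‖)⁻¹ • v := by
    intro v
    funext i
    rw [hwv]
    dsimp only
    rw [hsigval, Pi.smul_apply, smul_eq_mul]
    ring
  have hradsig : ∀ v, cubeRad (sig v) = 2 * ‖v‖ * (1 + 2 * ‖v‖)⁻¹ := by
    intro v
    rw [hrad, hwsig, norm_smul, norm_inv, Real.norm_of_nonneg (hden v).le]
    ring
  have hsigU : ∀ v, sig v ∈ U := by
    intro v
    show cubeRad (sig v) < 1
    rw [hradsig, mul_inv_lt_iff₀ (hden v)]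
    linarith
  have htausig : ∀ v, τ (sig v) = v := by
    intro v
    rw [hτ]
    dsimp only
    rw [hradsig, hwsig, smul_smul]
    have : (1 - 2 * ‖v‖ * (1 + 2 * ‖v‖)⁻¹)⁻¹ * (1 + 2 * ‖v‖)⁻¹ = 1 := by
      have h0 : (1 + 2 * ‖v‖) ≠ 0 := (hden v).ne'
      field_simp
      ring
    rw [this, one_smul]
  have hsigtau : ∀ x ∈ U, sig (τ x) = x := by
    intro x hx
    have hr : cubeRad x < 1 := hx
    have hr1 : (1 - cubeRad x) ≠ 0 := (sub_pos.2 hr).ne'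
    have hnτ : ‖τ x‖ = (cubeRad x / 2) * (1 - cubeRad x)⁻¹ := by
      rw [hτ]
      dsimp only
      rw [norm_smul, norm_inv, Real.norm_of_nonneg (sub_nonneg.2 hr.le), hrad]
      ring
    have hcoef : (1 + 2 * ‖τ x‖)⁻¹ * (1 - cubeRad x)⁻¹ = 1 := by
      rw [hnτ]
      field_simp
      ring
    funext i
    apply Subtype.ext
    rw [hsigval]
    have : τ x i = (1 - cubeRad x)⁻¹ * ((x i : ℝ) - 2⁻¹) := by
      rw [hτ]
      rfl
    rw [this, ← mul_assoc, hcoef, one_mul]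
    ring
  -- the sphere map `g : ℝᴺ ∪ {∞} → Y`, `g ∘ c = f`
  let g : OnePoint (Fin N → ℝ) → Y := fun z => z.elim y fun v => f (sig v)
  have hgc : ∀ x, g (c x) = f x := by
    intro x
    by_cases hx : x ∈ U
    · show g (OnePointMaps.coeOrInfty U τ x) = f x
      rw [OnePointMaps.coeOrInfty_of_mem hx]
      show f (sig (τ x)) = f x
      rw [hsigtau x hx]
    · show g (OnePointMaps.coeOrInfty U τ x) = f x
      rw [OnePointMaps.coeOrInfty_of_not_mem hx]
      exact (hfb x (hbd_of_not_mem x hx)).symm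
  -- `g` is continuous: at `∞` because `f ∘ sig → y` at infinity (compactness of the cube)
  have hg : Continuous g := by
    rw [OnePoint.continuous_iff]
    refine ⟨?_, f.1.continuous.comp hsigc⟩
    show Tendsto (fun v : Fin N → ℝ => f (sig v)) (coclosedCompact (Fin N → ℝ)) (𝓝 y)
    rw [Filter.coclosedCompact_eq_cocompact, Filter.tendsto_def]
    intro W hW
    obtain ⟨W', hW'W, hW'o, hyW'⟩ := mem_nhds_iff.1 hW
    rw [Filter.mem_cocompact]
    set K : Set (Fin N → I) := {x | f x ∉ W'} with hK
    have hKc : IsCompact K :=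
      (hW'o.isClosed_compl.preimage f.1.continuous).isCompact
    have hKU : ∀ x ∈ K, cubeRad x < 1 := by
      intro x hx
      by_contra hxU
      exact hx (by rw [hfb x (hbd_of_not_mem x hxU)]; exact hyW')
    rcases K.eq_empty_or_nonempty with hKe | hKne
    · refine ⟨∅, isCompact_empty, fun v _ => hW'W ?_⟩
      by_contra hv
      have : sig v ∈ K := hv
      rw [hKe] at this
      exact this
    · obtain ⟨x₀, hx₀K, hmax⟩ := hKc.exists_isMaxOn hKne continuous_cubeRad.continuousOn
      set r := cubeRad x₀ with hr
      have hr1 : r < 1 := hKU x₀ hx₀K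
      have hr0 : 0 ≤ r := cubeRad_nonneg x₀
      refine ⟨closedBall 0 (r / (2 * (1 - r))), isCompact_closedBall 0 _, fun v hv => hW'W ?_⟩
      by_contra hvW
      have hvK : sig v ∈ K := hvW
      have hle : cubeRad (sig v) ≤ r := hmax hvK
      rw [hradsig, mul_inv_le_iff₀ (hden v)] at hle
      apply hv
      rw [mem_closedBall, dist_zero_right, le_div_iff₀ (by linarith)]
      nlinarith [norm_nonneg v]
  -- `ℝᴺ ∪ {∞} ≅ Sᴺ`, the sphere map, and its free null-homotopy
  let e : OnePoint (Fin N → ℝ) ≃ₜ sphere (0 : EuclideanSpace ℝ (Fin (N + 1))) 1 :=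
    ((EuclideanSpace.equiv (Fin N) ℝ).symm.toHomeomorph.onePointCongr).trans
      (onePointEuclideanHomeomorphSphere N)
  let gS : C(sphere (0 : EuclideanSpace ℝ (Fin (N + 1))) 1, Y) := ⟨g ∘ e.symm, hg.comp e.symm.continuous⟩
  have hgS : ∀ z, gS (e z) = g z := fun z => by
    show g (e.symm (e z)) = g z
    rw [e.symm_apply_apply]
  -- the collapse loop `κ = e ∘ c`
  let κ : Ω^ (Fin N) (sphere (0 : EuclideanSpace ℝ (Fin (N + 1))) 1) (e ∞) :=
    ⟨⟨fun x => e (c x), e.continuous.comp hcc⟩, fun x hx => by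
      show e (c x) = e ∞
      rw [show c x = ∞ from OnePointMaps.coeOrInfty_of_not_mem (hnot_mem_of_bd x hx)]⟩
  refine ⟨e ∞, κ, gS, ?_, ?_⟩
  · rw [hgS]; rfl
  · ext x
    show gS (e (c x)) = f x
    rw [hgS, hgc]

/-- **Every class in `π_N(Y, y)` is `g_* [κ]` for a map of the sphere** (Hatcher 2002, §4.1
p. 340): for every `γ ∈ π_N(Y, y)` there are `s ∈ Sᴺ` and a continuous `g : Sᴺ → Y` with `g s = y`
such that `γ` lies in the image of `g_* : π_N(Sᴺ, s) → π_N(Y, y)`. [cite: HatcherAT2002, §4.1 p. 340] -/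
theorem exists_sphereMap_mem_range (γ : HomotopyGroup (Fin N) Y y) :
    ∃ (s : sphere (0 : EuclideanSpace ℝ (Fin (N + 1))) 1)
      (g : C(sphere (0 : EuclideanSpace ℝ (Fin (N + 1))) 1, Y)) (hg : y = g s),
      γ ∈ Set.range (homotopyGroupMapOfEq (N := Fin N) g hg) := by
  induction γ using Quotient.inductionOn with
  | h f =>
    obtain ⟨s, κ, g, hg, hκ⟩ := exists_sphereMap_genLoop_eq f
    exact ⟨s, g, hg, ⟦κ⟧, by rw [homotopyGroupMapOfEq_mk, hκ]⟩

end Literature.AlgebraicTopology.Homotopy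

end
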